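import Literature.MathematicalPhysics.QuantumLattice.HeatKernelGroupConvolutionProofs
import HarnessLib

/-!
# Strong-coupling floor engine, part 1: convolution powers of a symmetric kernel are positive at `1`

Pooled prover `ym-ir-line-bsf-p1` (crux `IR`, stmt-QuantumFields-19354; director-ym R366 pooled queue), support file for
the volume-uniform strong-coupling LOWER bound on the facing-plaquette covariance (`FacingPlaquetteCovFloor`): the
leading Taylor coefficient of that covariance is the Haar integral of the unit cube, which gauge-fixes to the six-fold
convolution power `φ^{*6}(1)` of the real class function `φ = Re tr ρ − m₀`.  Here: for a continuous real kernel `k` on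
a compact group with `k(g⁻¹) = k(g)` and `k ≢ 0`, every EVEN convolution power is strictly positive at the identity,
`k^{*(2m+2)}(1) = ∫ (k^{*(m+1)})² > 0` (`convIter_odd_apply_one_pos`), by the chain
`k^{*n} ≡ 0 ⇒ k ≡ 0` (`eq_zero_of_convIter_eq_zero`).  No characters, no Peter–Weyl.

Conventions: `haarConv k f x = ∫ k(h) f(h⁻¹x) dh` (tree, `HeatKernelGroupConvolutionProofs`), Haar probability measure
`haarProbability G`; `(haarConv k)^[n] k = k^{*(n+1)}` (Mathlib `Function.iterate`, no new definition).  Everything is proved; group-theory plumbing only — nothing here bears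
on the Yang–Mills mass gap.
-/

set_option autoImplicit false

noncomputable section

open MeasureTheory Filter Topology
open Literature.MathematicalPhysics.QuantumFieldTheory (haarProbability)
open Literature.MathematicalPhysics.QuantumLattice

namespace Summit.QuantumFields.YangMills.Cruxes.IR.SCFloor

variable {G : Type*} [Group G] [TopologicalSpace G] [IsTopologicalGroup G] [CompactSpace G]
  [MeasurableSpace G] [BorelSpace G]

/-! Convolution powers are written with `Function.iterate`: `(haarConv k)^[n] k = k^{*(n+1)}` (no new definition). -/

/-- `(haarConv k)^[0] k = k`. -/
theorem convIter_zero (k : G → ℝ) : (haarConv k)^[0] k = k := rfl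

/-- `(haarConv k)^[n+1] k = k ⋆ (haarConv k)^[n] k`. -/
theorem convIter_succ (k : G → ℝ) (n : ℕ) : (haarConv k)^[n + 1] k = haarConv k ((haarConv k)^[n] k) :=
  Function.iterate_succ_apply' _ _ _

/-- Convolution powers of a continuous kernel are continuous. -/
theorem continuous_convIter {k : G → ℝ} (hk : Continuous k) : ∀ n, Continuous ((haarConv k)^[n] k)
  | 0 => hk
  | n + 1 => by
    rw [convIter_succ]
    exact continuous_haarConv hk (((continuous_convIter hk n)).integrable_of_hasCompactSupport
      (HasCompactSupport.of_compactSpace _))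

/-- For symmetric `k` and `f` (`k(g⁻¹) = k g`, `f(g⁻¹) = f g`): `(k ⋆ f)(x⁻¹) = (f ⋆ k)(x)`. -/
theorem haarConv_apply_inv_of_symm {k f : G → ℝ} (hk : ∀ g, k g⁻¹ = k g) (hf : ∀ g, f g⁻¹ = f g)
    (x : G) : haarConv k f x⁻¹ = haarConv f k x := by
  rw [haarConv_eq_integral_mul_inv, haarConv_apply]
  rw [← integral_inv_eq_self (fun h => f h * k (h⁻¹ * x)) (haarProbability G)]
  refine integral_congr_ae (Eventually.of_forall fun h => ?_)
  dsimp only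
  rw [inv_inv, ← hk (x⁻¹ * h⁻¹), mul_inv_rev, inv_inv, inv_inv, hf, mul_comm]

section T2

variable [T2Space G]

/-- Power law: `k^{*(m+n+2)} = k^{*(m+1)} ⋆ k^{*(n+1)}`, i.e.
`(haarConv k)^[m+n+1] k = (haarConv k)^[m] k ⋆ (haarConv k)^[n] k` (associativity of convolution). -/
theorem convIter_add (k : G → ℝ) (hk : Continuous k) (m n : ℕ) :
    (haarConv k)^[m + n + 1] k = haarConv ((haarConv k)^[m] k) ((haarConv k)^[n] k) := by
  induction m with
  | zero => simp [convIter_succ]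
  | succ m ih =>
    rw [show m + 1 + n + 1 = (m + n + 1) + 1 by ring, convIter_succ, ih, convIter_succ,
      haarConv_haarConv hk (continuous_convIter hk m) (continuous_convIter hk n)]

/-- Convolution powers of a symmetric continuous kernel are symmetric. -/
theorem convIter_symm {k : G → ℝ} (hk : Continuous k) (hks : ∀ g, k g⁻¹ = k g) :
    ∀ n (g : G), ((haarConv k)^[n] k) g⁻¹ = ((haarConv k)^[n] k) g
  | 0, g => hks g
  | n + 1, g => by
    rw [convIter_succ, haarConv_apply_inv_of_symm hks (convIter_symm hk hks n)]
    -- `k^{*(n+1)} ⋆ k = k ⋆ k^{*(n+1)}` by the power law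
    have h := convIter_add k hk n 0
    rw [convIter_zero] at h
    rw [← h, show n + 0 + 1 = n + 1 by ring, convIter_succ]

/-- `k^{*(2m+2)}(1) = ∫ (k^{*(m+1)})²` for a symmetric continuous kernel. -/
theorem convIter_odd_apply_one {k : G → ℝ} (hk : Continuous k) (hks : ∀ g, k g⁻¹ = k g) (m : ℕ) :
    ((haarConv k)^[2 * m + 1] k) 1 = ∫ h, (((haarConv k)^[m] k) h) ^ 2 ∂haarProbability G := by
  rw [show 2 * m + 1 = m + m + 1 by ring, convIter_add k hk m m,
    haarConv_apply_one_of_symm (convIter_symm hk hks m)]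
  simp [sq]

/-- **The chain**: if some convolution power of a symmetric continuous kernel vanishes identically, so does the kernel. -/
theorem eq_zero_of_convIter_eq_zero {k : G → ℝ} (hk : Continuous k) (hks : ∀ g, k g⁻¹ = k g) :
    ∀ n, (haarConv k)^[n] k = 0 → k = 0 := by
  intro n
  induction n using Nat.strong_induction_on with
  | _ n ih =>
    intro hn
    -- an odd index `2m+1 ≤ n+1` whose power vanishes
    have hsq : ∀ m, (haarConv k)^[2 * m + 1] k = 0 → (haarConv k)^[m] k = 0 := by
      intro m hm
      have h0 : ∫ h, (((haarConv k)^[m] k) h) ^ 2 ∂haarProbability G = 0 := by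
        rw [← convIter_odd_apply_one hk hks m, hm]; rfl
      have hc := continuous_convIter hk m
      have hnn : 0 ≤ fun h => (((haarConv k)^[m] k) h) ^ 2 := fun h => sq_nonneg _
      have hint : Integrable (fun h => (((haarConv k)^[m] k) h) ^ 2) (haarProbability G) :=
        (hc.pow 2).integrable_of_hasCompactSupport (HasCompactSupport.of_compactSpace _)
      have hae := (integral_eq_zero_iff_of_nonneg hnn hint).1 h0
      have heq : (fun h => (((haarConv k)^[m] k) h) ^ 2) = 0 :=
        (Continuous.ae_eq_iff_eq (haarProbability G) (hc.pow 2) continuous_const).1 hae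
      funext h
      have := congr_fun heq h
      simpa using this
    rcases Nat.even_or_odd n with ⟨m, rfl⟩ | ⟨m, rfl⟩
    · -- `n = 2m`: then `k^{*(n+2)} = k ⋆ 0 = 0`, index `n + 1 = 2m + 1`
      rcases Nat.eq_zero_or_pos m with rfl | hm
      · simpa using hn
      · have h1 : (haarConv k)^[m + m + 1] k = 0 := by
          rw [convIter_succ, hn]; funext x; simp [haarConv_apply]
        have h2 : (haarConv k)^[m] k = 0 := hsq m (by rw [two_mul]; exact h1)
        exact ih m (by omega) h2
    · -- `n = 2m+1`
      exact ih m (by omega) (hsq m hn)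

/-- **Positivity of even convolution powers at the identity**: for a continuous symmetric kernel `k ≢ 0`,
`k^{*(2m+2)}(1) = ∫ (k^{*(m+1)})² > 0`. -/
theorem convIter_odd_apply_one_pos {k : G → ℝ} (hk : Continuous k) (hks : ∀ g, k g⁻¹ = k g)
    (hk0 : k ≠ 0) (m : ℕ) : 0 < ((haarConv k)^[2 * m + 1] k) 1 := by
  rw [convIter_odd_apply_one hk hks m]
  have hc := continuous_convIter hk m
  have hint : Integrable (fun h => (((haarConv k)^[m] k) h) ^ 2) (haarProbability G) :=
    (hc.pow 2).integrable_of_hasCompactSupport (HasCompactSupport.of_compactSpace _)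
  refine lt_of_le_of_ne (integral_nonneg fun h => sq_nonneg _) fun h0 => hk0 ?_
  have hae := (integral_eq_zero_iff_of_nonneg (fun h => sq_nonneg _) hint).1 h0.symm
  have heq : (fun h => (((haarConv k)^[m] k) h) ^ 2) = 0 :=
    (Continuous.ae_eq_iff_eq (haarProbability G) (hc.pow 2) continuous_const).1 hae
  refine eq_zero_of_convIter_eq_zero hk hks m ?_
  funext h
  have := congr_fun heq h
  simpa using this

/-- The case used by the cube integral: `k^{*6}(1) > 0`. -/
theorem convIter_five_apply_one_pos {k : G → ℝ} (hk : Continuous k) (hks : ∀ g, k g⁻¹ = k g)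
    (hk0 : k ≠ 0) : 0 < ((haarConv k)^[5] k) 1 :=
  convIter_odd_apply_one_pos hk hks hk0 2

end T2

end Summit.QuantumFields.YangMills.Cruxes.IR.SCFloor

end
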